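import Summits.Ventures.HSemireg.ObstructionLocusBlockArrangement
import Summits.Ventures.HSemireg.ObstructionLocusLocalBranches

/-!
# Venture HSemireg — (S5) OBSTRUCTION LOCUS away from secant type, XVII: the BLOCK MODELS `M(S_1, …, S_r)` —
# the `V`-scaled branch map of a block, «NO POLES» (its range catches every `φ(gen i a)`), and the branch
# coordinates `ρ_{i,a} : Hom_R(I_M, R/I_{S_i}) → Π_{b ∈ S_i ∖ a} R/(x_b, x_a)`

HONEST FRAMING.  Companion of `ObstructionLocusBlockIdeal/Arrangement.lean` (cell `pub-hsemireg`, track «S4-PUSH» (ii), seat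
s4-prove-2; vocabulary and honest framing as there): plain commutative algebra in `R = MvPolynomial (Fin n) K`, `K` any
commutative ring, every `n`, every block structure; nothing here constructs a variety or a sheaf; nothing here says
that HC / HC_CM / HC_AV holds; no Literature fact is declared or used.  This file is the «NO POLES» half of
EXT-NOTE §6.B(a) for every block model: an `R`-linear `φ : I_M → R/I_{S_i}` takes the test element
`gen i a = x_{S_i ∖ a} x_{rest i}` to a combination `Σ_b r_b · x_{S_i ∖ {a,b}} x_{rest i}` of the branch partners —
with the factor `x_{rest i}` INTACT (printed form: «`φ(x_a)|_B ∈ A_B`, no poles along the other blocks»; here: free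
coordinates divide exactly in `R/I_{S_i}`, file XV `apply_ne_zero_of_mk_eq_X_smul`, and step A).

* `branchMapV B i a : R^{S_i ∖ a} → R/I_{S_i}`, `r ↦ Σ_b r_b · genPartner i a b`; **`ker_branchMapV`** — its kernel is
  EXACTLY `⊕_b (x_b, x_a)` (the monomial `x^e · genPartner i a b₀` with `e_a = e_{b₀} = 0` survives and has two zero
  exponents in `S_i`).
* `exists_partner` — exponent bookkeeping: `x_a x^e ∈ I_S ∌ x^e` forces `e` to vanish exactly at `a` and ONE partner
  `b`, with `S ∖ {a, b} ⊂ supp e`.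
* **`apply_gen_mem_range`** — «NO POLES»: `φ(gen i a) ∈ range (branchMapV B i a)` for every `R`-linear
  `φ : I_M → R/I_{S_i}`.
* `rangeBranchEquiv`, **`rhoLoc B i a : Hom_R(I_M, R/I_{S_i}) →ₗ[R] Π_{b ∈ S_i ∖ a} R/(x_b, x_a)`** (the branch
  coordinates of `φ` at the generator `a` of block `i`), `rhoLoc_apply_of_eq` (computes it from any expression
  `φ(gen i a) = Σ_b r_b genPartner i a b`), `apply_gen_eq_zero_of_rhoLoc_eq_zero`.
* **`eq_zero_of_apply_gen_eq_zero`** — a `φ : I_M → R/I_{S_i}` killing every `gen i a`, `a ∈ S_i`, is zero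
  (`x_{rest i}` is a non-zero-divisor on `R/I_{S_i}` and every monomial of `I_M` is `x^d · x_{S_i ∖ a}` for some `a`).
References (dictionary only): EXT-NOTE.md §6.B(a) (i)–(iii), (v); G2-REDUCIBLE-POINT-THEOREM.md §2 L1 (i).
-/

open scoped BigOperators
open MvPolynomial Finset

namespace Summit.Ventures.HSemireg.ObstructionLocus.BlockModel

variable {K : Type*} [CommRing K] {n : ℕ} {ι : Type*} [Fintype ι] [DecidableEq ι]

/-! ## The `V`-scaled branch map of block `i` at the generator `a` -/

/-- `β_{i,a} : R^{S_i ∖ a} → R/I_{S_i}`, `r ↦ Σ_b r_b · x_{S_i ∖ {a,b}} x_{rest i} mod I_{S_i}`. -/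
noncomputable def branchMapV (B : Blocks ι n) (i : ι) (a : Fin n) :
    (↥((B.S i).erase a) → MvPolynomial (Fin n) K) →ₗ[MvPolynomial (Fin n) K]
      MvPolynomial (Fin n) K ⧸ blockIdeal K (B.S i) :=
  ∑ b, (LinearMap.proj b).smulRight (Ideal.Quotient.mk (blockIdeal K (B.S i)) (genPartner B i a b.1))

/-- `β_{i,a} r = Σ_b r_b genPartner i a b mod I_{S_i}`. -/
theorem branchMapV_apply (B : Blocks ι n) (i : ι) (a : Fin n) (r : ↥((B.S i).erase a) → MvPolynomial (Fin n) K) :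
    branchMapV B i a r = Ideal.Quotient.mk (blockIdeal K (B.S i)) (∑ b, r b * genPartner B i a b.1) := by
  simp only [branchMapV, LinearMap.sum_apply, LinearMap.smulRight_apply, LinearMap.proj_apply, smul_mk_eq,
    map_sum]

/-- `β_{i,a} e_b = genPartner i a b mod I_{S_i}`. -/
theorem branchMapV_single (B : Blocks ι n) (i : ι) (a : Fin n) (b : ↥((B.S i).erase a)) :
    branchMapV B i a (Pi.single b 1) = Ideal.Quotient.mk (blockIdeal K (B.S i)) (genPartner B i a b.1) := by
  rw [branchMapV_apply, Finset.sum_eq_single b]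
  · simp
  · intro l _ hl; simp [hl]
  · intro h; exact absurd (mem_univ b) h

/-- `(x_b, x_a) e_b ⊆ ker β_{i,a}`: `x_b genPartner i a b = gen i a`, `x_a genPartner i a b = gen i b`, both in
`I_M ⊂ I_{S_i}`. -/
theorem pi_le_ker_branchMapV (B : Blocks ι n) (i : ι) {a : Fin n} (ha : a ∈ B.S i) :
    Submodule.pi Set.univ (fun b : ↥((B.S i).erase a) =>
        (Ideal.span {(X b.1 : MvPolynomial (Fin n) K), X a} : Submodule (MvPolynomial (Fin n) K) _))
      ≤ LinearMap.ker (branchMapV (K := K) B i a) := by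
  intro r hr
  rw [LinearMap.mem_ker, branchMapV_apply, Ideal.Quotient.eq_zero_iff_mem]
  refine Ideal.sum_mem _ fun b _ => ?_
  obtain ⟨p, q, hpq⟩ := Ideal.mem_span_pair.1 (hr b (Set.mem_univ b))
  rw [← hpq, add_mul, mul_assoc, mul_assoc, X_mul_genPartner B b.2, X_mul_genPartner' B ha b.2]
  exact Ideal.add_mem _ (Ideal.mul_mem_left _ _ (arrIdeal_le B i (gen_mem B ha)))
    (Ideal.mul_mem_left _ _ (arrIdeal_le B i (gen_mem B (mem_erase.1 b.2).2)))

/-- **`ker β_{i,a} = ⊕_b (x_b, x_a)`**: if `Σ_b r_b genPartner i a b ∈ I_{S_i}` then every `r_b ∈ (x_b, x_a)`. -/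
theorem ker_branchMapV (B : Blocks ι n) (i : ι) {a : Fin n} (ha : a ∈ B.S i) :
    LinearMap.ker (branchMapV (K := K) B i a)
      = Submodule.pi Set.univ (fun b : ↥((B.S i).erase a) =>
        (Ideal.span {(X b.1 : MvPolynomial (Fin n) K), X a} : Submodule (MvPolynomial (Fin n) K) _)) := by
  classical
  refine le_antisymm ?_ (pi_le_ker_branchMapV B i ha)
  intro r hr b₀ _
  rw [LinearMap.mem_ker, branchMapV_apply, Ideal.Quotient.eq_zero_iff_mem] at hr
  rw [SetLike.mem_coe, mem_span_X_pair_iff]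
  intro e he
  by_contra hnot
  push Not at hnot
  obtain ⟨heb, hea⟩ := hnot
  have hb₀S : b₀.1 ∈ B.S i := (mem_erase.1 b₀.2).2
  have hb₀a : b₀.1 ≠ a := (mem_erase.1 b₀.2).1
  -- the exponent of the surviving monomial `x^e · genPartner i a b₀`
  set T : ↥((B.S i).erase a) → Finset (Fin n) := fun b => ((B.S i).erase a).erase b.1 ∪ B.rest i with hT
  set E : Fin n →₀ ℕ := e + ind (T b₀) with hE
  have hgp : ∀ b : ↥((B.S i).erase a), (genPartner B i a b.1 : MvPolynomial (Fin n) K) = monomial (ind (T b)) 1 :=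
    fun b => sq_eq_monomial _
  have hEb₀ : E b₀.1 = 0 := by
    rw [hE, Finsupp.add_apply, heb, zero_add, ind_apply_of_notMem]
    rw [hT, mem_union, not_or]
    exact ⟨Finset.notMem_erase _ _, B.notMem_rest hb₀S⟩
  have hEa : E a = 0 := by
    rw [hE, Finsupp.add_apply, hea, zero_add, ind_apply_of_notMem]
    rw [hT, mem_union, not_or]
    exact ⟨fun h => Finset.notMem_erase a _ (mem_erase.1 h).2, B.notMem_rest ha⟩
  have hcoeff : coeff E (∑ b, r b * genPartner B i a b.1) = coeff e (r b₀) := by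
    rw [coeff_sum, Finset.sum_eq_single b₀]
    · rw [hgp, coeff_mul_monomial', if_pos (by rw [hE]; exact le_add_self), mul_one, hE, add_tsub_cancel_right]
    · intro b _ hb
      rw [hgp, coeff_mul_monomial', if_neg]
      intro hle
      have h1 := hle b₀.1
      have hmem : b₀.1 ∈ T b := by
        rw [hT, mem_union]
        exact Or.inl (mem_erase.2 ⟨fun h => hb (Subtype.ext h).symm, b₀.2⟩)
      rw [ind_apply_of_mem hmem, hEb₀] at h1
      omega
    · intro h; exact absurd (mem_univ b₀) h
  have hEsupp : E ∈ (∑ b, r b * genPartner B i a b.1).support := by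
    rw [mem_support_iff, hcoeff]; exact mem_support_iff.1 he
  obtain ⟨a', ha', hsub⟩ := mem_blockIdeal_iff.1 hr E hEsupp
  -- but `E` vanishes at the two distinct coordinates `a`, `b₀` of `S_i`
  by_cases haa : a' = a
  · subst haa
    have := hsub (mem_erase.2 ⟨hb₀a, hb₀S⟩)
    rw [Finsupp.mem_support_iff] at this
    exact this hEb₀
  · have := hsub (mem_erase.2 ⟨fun h => haa h.symm, ha⟩)
    rw [Finsupp.mem_support_iff] at this
    exact this hEa

/-! ## «NO POLES»: the range of `β_{i,a}` catches `φ(gen i a)` -/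

/-- Exponent bookkeeping: if `x_a x^e ∈ I_S` but `x^e ∉ I_S` (`a ∈ S`), then `e` vanishes at `a` and at exactly one
partner `b ∈ S ∖ a`, with `S ∖ {a, b} ⊂ supp e`. -/
theorem exists_partner {S : Finset (Fin n)} {a : Fin n} (ha : a ∈ S) {e : Fin n →₀ ℕ}
    (h1 : BlockMem S (Finsupp.single a 1 + e)) (h2 : ¬ BlockMem S e) :
    ∃ b ∈ S.erase a, (S.erase a).erase b ⊆ e.support := by
  have key : ∀ c, c ≠ a → c ∈ (Finsupp.single a 1 + e).support → c ∈ e.support := by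
    intro c hca hc
    rw [Finsupp.mem_support_iff, Finsupp.add_apply, Finsupp.single_apply, if_neg (fun h => hca h.symm),
      zero_add] at hc
    exact Finsupp.mem_support_iff.2 hc
  obtain ⟨a', ha', hs⟩ := h1
  by_cases haa : a' = a
  · subst haa
    exact absurd ⟨a', ha', fun c hc => key c (mem_erase.1 hc).1 (hs hc)⟩ h2
  · refine ⟨a', mem_erase.2 ⟨haa, ha'⟩, fun c hc => ?_⟩
    have hca' : c ≠ a' := (mem_erase.1 hc).1
    have hca : c ≠ a := (mem_erase.1 (mem_erase.1 hc).2).1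
    have hcS : c ∈ S := (mem_erase.1 (mem_erase.1 hc).2).2
    exact key c hca (hs (mem_erase.2 ⟨hca', hcS⟩))

/-- The test element with one free coordinate removed is still in `I_M`: `gen i a = x_c · x_{(S_i ∖ a ∪ rest i) ∖ c}`
for `c ∈ rest i`, and the second factor lies in `I_M`. -/
theorem sq_erase_free_mem (B : Blocks ι n) {i : ι} {a c : Fin n} (ha : a ∈ B.S i) (hc : c ∈ B.rest i) :
    (sq (((B.S i).erase a ∪ B.rest i).erase c) : MvPolynomial (Fin n) K) ∈ arrIdeal K B := by
  have hci : c ∉ B.S i := fun h => B.notMem_rest h hc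
  refine sq_mem_arrIdeal fun j => ?_
  by_cases hj : j = i
  · subst hj
    refine ⟨a, ha, fun d hd => mem_erase.2 ⟨?_, mem_union_left _ hd⟩⟩
    rintro rfl
    exact hci (mem_erase.1 hd).2
  · by_cases hcj : c ∈ B.S j
    · refine ⟨c, hcj, fun d hd => mem_erase.2 ⟨(mem_erase.1 hd).1, mem_union_right _ ?_⟩⟩
      exact B.subset_rest hj (mem_erase.1 hd).2
    · obtain ⟨d₀, hd₀⟩ := B.nonempty j
      refine ⟨d₀, hd₀, fun d hd => mem_erase.2 ⟨?_, mem_union_right _ (B.subset_rest hj (mem_erase.1 hd).2)⟩⟩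
      rintro rfl
      exact hcj (mem_erase.1 hd).2

/-- **«NO POLES».**  For every `R`-linear `φ : I_M → R/I_{S_i}` and every `a ∈ S_i`, the value `φ(gen i a)` is a
combination `Σ_b r_b · genPartner i a b` of the branch partners — the free factor `x_{rest i}` survives intact. -/
theorem apply_gen_mem_range (B : Blocks ι n) {i : ι}
    (φ : ↥(arrIdeal K B) →ₗ[MvPolynomial (Fin n) K] MvPolynomial (Fin n) K ⧸ blockIdeal K (B.S i))
    (a : ↥(B.S i)) :
    φ ⟨gen B i a.1, gen_mem B a.2⟩ ∈ LinearMap.range (branchMapV B i a.1) := by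
  classical
  obtain ⟨g, hg⟩ := Ideal.Quotient.mk_surjective (φ ⟨gen B i a.1, gen_mem B a.2⟩)
  set G := stdPart (B.S i) g with hG
  -- (F1) `x_a G ∈ I_{S_i}` by step A
  have hF1 : X a.1 * G ∈ blockIdeal K (B.S i) := by
    have h0 : X a.1 * g ∈ blockIdeal K (B.S i) := by
      rw [← Ideal.Quotient.eq_zero_iff_mem, ← smul_mk_eq, hg]
      exact X_smul_apply_gen_eq_zero B φ a
    have h1 : X a.1 * G - X a.1 * g ∈ blockIdeal K (B.S i) := by
      rw [← mul_sub]
      exact Ideal.mul_mem_left _ _ (stdPart_sub_mem (B.S i) g)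
    have := Ideal.add_mem _ h1 h0
    rwa [sub_add_cancel] at this
  -- (F2) every free coordinate of the other blocks divides the monomials of `G`
  have hF2 : ∀ e ∈ G.support, ∀ c ∈ B.rest i, e c ≠ 0 := by
    intro e he c hc
    have hci : c ∉ B.S i := fun h => B.notMem_rest h hc
    have hmem : c ∈ (B.S i).erase a.1 ∪ B.rest i := mem_union_right _ hc
    obtain ⟨h', hh'⟩ := Ideal.Quotient.mk_surjective
      (φ ⟨sq (((B.S i).erase a.1 ∪ B.rest i).erase c), sq_erase_free_mem B a.2 hc⟩)
    refine apply_ne_zero_of_mk_eq_X_smul hci (h := h') ?_ he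
    rw [hg, hh', ← map_smul]
    congr 1
    apply Subtype.ext
    change gen B i a.1 = X c * sq (((B.S i).erase a.1 ∪ B.rest i).erase c)
    rw [gen, X_mul_sq_erase hmem]
  -- hence every monomial of `G` is a multiple of some `genPartner i a b`
  have hspan : G ∈ Ideal.span ((fun e => monomial e (1 : K)) ''
      ((fun b : ↥((B.S i).erase a.1) => ind (((B.S i).erase a.1).erase b.1 ∪ B.rest i)) '' Set.univ)) := by
    rw [mem_ideal_span_monomial_image]
    intro e he
    have h1 : BlockMem (B.S i) (Finsupp.single a.1 1 + e) := by
      refine mem_blockIdeal_iff.1 hF1 _ ?_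
      rw [mem_support_iff, coeff_X_mul]
      exact mem_support_iff.1 he
    obtain ⟨b, hb, hsub⟩ := exists_partner a.2 h1 (not_blockMem_of_mem_support_stdPart he)
    refine ⟨_, ⟨⟨b, hb⟩, Set.mem_univ _, rfl⟩, ind_le_iff.2 ?_⟩
    intro d hd
    rcases mem_union.1 hd with hd | hd
    · exact hsub hd
    · exact Finsupp.mem_support_iff.2 (hF2 e he d hd)
  -- and the span of those monomials maps into `range β_{i,a}`
  have hle : Ideal.span ((fun e => monomial e (1 : K)) ''
      ((fun b : ↥((B.S i).erase a.1) => ind (((B.S i).erase a.1).erase b.1 ∪ B.rest i)) '' Set.univ))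
        ≤ Submodule.comap (Submodule.mkQ (blockIdeal K (B.S i))) (LinearMap.range (branchMapV B i a.1)) := by
    rw [Ideal.span_le]
    rintro _ ⟨_, ⟨b, -, rfl⟩, rfl⟩
    rw [SetLike.mem_coe, Submodule.mem_comap, Submodule.mkQ_apply]
    dsimp only
    rw [← sq_eq_monomial]
    refine ⟨Pi.single b 1, ?_⟩
    rw [branchMapV_single]
    rfl
  have := hle hspan
  rw [Submodule.mem_comap, Submodule.mkQ_apply] at this
  rw [← hg, ← mk_stdPart]
  exact this

/-! ## The branch coordinates `ρ_{i,a}` -/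

/-- `range β_{i,a} ≅ R^{S_i ∖ a}/⊕_b (x_b, x_a) ≅ Π_{b ∈ S_i ∖ a} R/(x_b, x_a)`. -/
noncomputable def rangeBranchEquiv (B : Blocks ι n) (i : ι) {a : Fin n} (ha : a ∈ B.S i) :
    LinearMap.range (branchMapV (K := K) B i a) ≃ₗ[MvPolynomial (Fin n) K]
      ((b : ↥((B.S i).erase a)) → MvPolynomial (Fin n) K ⧸ Ideal.span {(X b.1 : MvPolynomial (Fin n) K), X a}) :=
  (LinearMap.quotKerEquivRange (branchMapV B i a)).symm
    ≪≫ₗ Submodule.quotEquivOfEq _ _ (ker_branchMapV B i ha)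
    ≪≫ₗ Submodule.quotientPi _

/-- The equivalence reads off the coefficients: `β_{i,a} r ↦ (r_b mod (x_b, x_a))_b`. -/
theorem rangeBranchEquiv_apply_mk (B : Blocks ι n) (i : ι) {a : Fin n} (ha : a ∈ B.S i)
    (r : ↥((B.S i).erase a) → MvPolynomial (Fin n) K) :
    rangeBranchEquiv B i ha ⟨branchMapV B i a r, LinearMap.mem_range_self _ r⟩
      = fun b => Ideal.Quotient.mk _ (r b) := by
  rw [rangeBranchEquiv, LinearEquiv.trans_apply, LinearEquiv.trans_apply,
    LinearMap.quotKerEquivRange_symm_apply_image, Submodule.mkQ_apply, Submodule.quotEquivOfEq_mk]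
  funext b
  simp only [Submodule.quotientPi_apply, Submodule.quotientPiLift_mk, Submodule.mkQ_apply]
  rfl

/-- **The branch coordinates of `φ` at the generator `a` of block `i`**:
`ρ_{i,a} : Hom_R(I_M, R/I_{S_i}) →ₗ[R] Π_{b ∈ S_i ∖ a} R/(x_b, x_a)`, `φ ↦ (r_b mod (x_b, x_a))_b` for any expression
`φ(gen i a) = Σ_b r_b genPartner i a b` (well defined by `ker_branchMapV`, total by «no poles»). -/
noncomputable def rhoLoc (B : Blocks ι n) (i : ι) (a : ↥(B.S i)) :
    (↥(arrIdeal K B) →ₗ[MvPolynomial (Fin n) K] MvPolynomial (Fin n) K ⧸ blockIdeal K (B.S i))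
      →ₗ[MvPolynomial (Fin n) K]
        ((b : ↥((B.S i).erase a.1)) → MvPolynomial (Fin n) K ⧸ Ideal.span {(X b.1 : MvPolynomial (Fin n) K), X a.1}) :=
  (rangeBranchEquiv B i a.2).toLinearMap ∘ₗ
    LinearMap.codRestrict (LinearMap.range (branchMapV B i a.1))
      (LinearMap.applyₗ (⟨gen B i a.1, gen_mem B a.2⟩ : ↥(arrIdeal K B))) (fun φ => apply_gen_mem_range B φ a)

/-- `ρ_{i,a}` computed from an expression `φ(gen i a) = β_{i,a} r`. -/
theorem rhoLoc_apply_of_eq (B : Blocks ι n) {i : ι} (a : ↥(B.S i))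
    {φ : ↥(arrIdeal K B) →ₗ[MvPolynomial (Fin n) K] MvPolynomial (Fin n) K ⧸ blockIdeal K (B.S i)}
    {r : ↥((B.S i).erase a.1) → MvPolynomial (Fin n) K}
    (h : φ ⟨gen B i a.1, gen_mem B a.2⟩ = branchMapV B i a.1 r) :
    rhoLoc B i a φ = fun b => Ideal.Quotient.mk _ (r b) := by
  rw [rhoLoc, LinearMap.comp_apply, LinearEquiv.coe_toLinearMap]
  have : LinearMap.codRestrict (LinearMap.range (branchMapV B i a.1))
      (LinearMap.applyₗ (⟨gen B i a.1, gen_mem B a.2⟩ : ↥(arrIdeal K B))) (fun φ => apply_gen_mem_range B φ a) φ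
        = ⟨branchMapV B i a.1 r, LinearMap.mem_range_self _ r⟩ := by
    apply Subtype.ext
    rw [LinearMap.codRestrict_apply]
    exact h
  rw [this, rangeBranchEquiv_apply_mk]

/-- If the branch coordinates vanish, so does `φ(gen i a)`. -/
theorem apply_gen_eq_zero_of_rhoLoc_eq_zero (B : Blocks ι n) {i : ι} (a : ↥(B.S i))
    {φ : ↥(arrIdeal K B) →ₗ[MvPolynomial (Fin n) K] MvPolynomial (Fin n) K ⧸ blockIdeal K (B.S i)}
    (h : rhoLoc B i a φ = 0) : φ ⟨gen B i a.1, gen_mem B a.2⟩ = 0 := by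
  rw [rhoLoc, LinearMap.comp_apply, LinearEquiv.coe_toLinearMap, LinearEquiv.map_eq_zero_iff] at h
  have := congr_arg Subtype.val h
  rw [LinearMap.codRestrict_apply] at this
  exact this

/-! ## A `φ : I_M → R/I_{S_i}` killing the test elements of block `i` is zero -/

omit [Fintype ι] [DecidableEq ι] in
/-- Every coefficient monomial of an element of `I_M` lies in `I_M` (monomial ideal). -/
theorem monomial_coeff_mem (B : Blocks ι n) {f : MvPolynomial (Fin n) K} (hf : f ∈ arrIdeal K B) (e : Fin n →₀ ℕ) :
    monomial e (coeff e f) ∈ arrIdeal K B := by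
  by_cases he : coeff e f = 0
  · rw [he, monomial_zero]; exact Submodule.zero_mem _
  · rw [mem_arrIdeal_iff]
    intro j
    exact monomial_mem_blockIdeal ((mem_arrIdeal_iff'.1 hf) e (mem_support_iff.2 he) j) _

omit [Fintype ι] [DecidableEq ι] in
/-- An element of `I_M` is the sum of its coefficient monomials, inside `I_M`. -/
theorem eq_sum_monomial_coeff (B : Blocks ι n) (f : ↥(arrIdeal K B)) :
    f = ∑ e ∈ f.1.support, (⟨monomial e (coeff e f.1), monomial_coeff_mem B f.2 e⟩ : ↥(arrIdeal K B)) := by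
  apply Subtype.ext
  rw [Submodule.coe_sum]
  exact f.1.as_sum

/-- `x_{rest i} · x^e = x^{e − 𝟙_{S_i ∖ a}} · gen i a` when `S_i ∖ a ⊂ supp e`. -/
theorem sq_rest_mul_monomial (B : Blocks ι n) {i : ι} {a : Fin n} {e : Fin n →₀ ℕ}
    (he : (B.S i).erase a ⊆ e.support) (c : K) :
    sq (B.rest i) * monomial e c = monomial (e - ind ((B.S i).erase a)) c * (gen B i a : MvPolynomial (Fin n) K) := by
  have hle : ind ((B.S i).erase a) ≤ e := ind_le_iff.2 he
  rw [gen, sq_union (Finset.disjoint_of_subset_left (erase_subset a _) (B.disjoint_rest i).symm), sq_eq_monomial,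
    sq_eq_monomial, monomial_mul, monomial_mul, monomial_mul, one_mul, mul_one, mul_one]
  congr 1
  rw [← add_assoc, tsub_add_cancel_of_le hle, add_comm]

/-- **A `φ : I_M → R/I_{S_i}` vanishing on every `gen i a`, `a ∈ S_i`, vanishes identically** (each monomial `x^e` of
`I_M` satisfies `x_{rest i} x^e = x^d gen i a` for the `a` at which `e` may vanish in `S_i`, and `x_{rest i}` is a
non-zero-divisor on `R/I_{S_i}`). -/
theorem eq_zero_of_apply_gen_eq_zero (B : Blocks ι n) {i : ι}
    (φ : ↥(arrIdeal K B) →ₗ[MvPolynomial (Fin n) K] MvPolynomial (Fin n) K ⧸ blockIdeal K (B.S i))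
    (h : ∀ a : ↥(B.S i), φ ⟨gen B i a.1, gen_mem B a.2⟩ = 0) : φ = 0 := by
  apply LinearMap.ext
  intro f
  rw [eq_sum_monomial_coeff B f, map_sum, LinearMap.zero_apply]
  refine Finset.sum_eq_zero fun e he => ?_
  obtain ⟨a, ha, hsub⟩ := (mem_arrIdeal_iff'.1 f.2) e he i
  apply eq_zero_of_sq_smul_eq_zero (B.disjoint_rest i)
  rw [← map_smul]
  have : (sq (B.rest i) : MvPolynomial (Fin n) K) • (⟨monomial e (coeff e f.1), monomial_coeff_mem B f.2 e⟩ :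
      ↥(arrIdeal K B)) = monomial (e - ind ((B.S i).erase a)) (coeff e f.1) • ⟨gen B i a, gen_mem B ha⟩ := by
    apply Subtype.ext
    change sq (B.rest i) * monomial e (coeff e f.1) = monomial (e - ind ((B.S i).erase a)) (coeff e f.1) * gen B i a
    exact sq_rest_mul_monomial B hsub _
  rw [this, map_smul, h ⟨a, ha⟩, smul_zero]

end Summit.Ventures.HSemireg.ObstructionLocus.BlockModel
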